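import Summits.QuantumFields.QCD.Theorems.QuarksAsStableActionStableActionBridgeChiralCriterion

/-!
# `IsChiralAtZero`: negation form and monotone strengthening
(crux `QuarksAsStableAction.StableActionBridge`, item stmt-QuantumFields-9737, line `Sketch`;
registered sub-goals `isChiralAtZero_iff_no_uniform_gap`, `isChiralAtZero_no_gap_above`)

The summit conjunct `QCDOf N_f` conjoins
`reg.IsChiralAtZero := ∀ ε > 0, ∃ m, (∀ f, 0 < m f) ∧ ¬ (reg.scheme m 0 0).HasLatticeMassGap ε`.
Routes arguing by contradiction need it in NEGATION FORM, and at the witness tuple in the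
monotone-strengthened form:

* `isChiralAtZero_iff_no_uniform_gap` — `reg.IsChiralAtZero` iff there is NO rate `ε > 0` that is a
  uniform lattice gap at ALL positive renormalised mass tuples (classical logic over the definition;
  the forward direction is `not_isChiralAtZero_of_uniform_gap`).
* `isChiralAtZero_no_gap_above` — at the witness tuple `m` for the rate `ε`, no rate `Δ ≥ ε` is a
  lattice gap either (`hasLatticeMassGap_anti`: a gap `Δ ≥ ε` would be a gap `ε`).

Pure logic over the tree's definitions (`QCDOS.lean`) and the landed `ChiralCriterion` lemmas.
-/

open Filter Literature.MathematicalPhysics.QuantumFieldTheory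

namespace Summit.QuantumFields.QCD.Cruxes.StableActionBridge.Sketch

/-- **Negation form of chirality at zero.** A regularisation is chiral at zero iff there is no
rate `ε > 0` which is a uniform lattice mass gap of `reg.scheme m 0 0` at every positive
renormalised mass tuple `m`. [folklore] -/
theorem isChiralAtZero_iff_no_uniform_gap : ∀ (Nf : ℕ) (reg : QCDRegularisation Nf), reg.IsChiralAtZero ↔ ¬ ∃ ε : ℝ, 0 < ε ∧ ∀ m : Fin Nf → ℝ, (∀ f, 0 < m f) → (reg.scheme m 0 0).HasLatticeMassGap ε := by
  intro Nf reg
  refine ⟨fun hχ hgap => not_isChiralAtZero_of_uniform_gap Nf reg hgap hχ, fun h ε hε => ?_⟩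
  by_contra hm
  exact h ⟨ε, hε, fun m hmpos => by_contra fun hng => hm ⟨m, hmpos, hng⟩⟩

/-- **Monotone strengthening of chirality at zero.** If `reg` is chiral at zero then for every
rate `ε > 0` there is a positive renormalised mass tuple `m` at which `reg.scheme m 0 0` has no
uniform lattice mass gap `Δ` for ANY `Δ ≥ ε` (a gap `Δ ≥ ε` would be a gap `ε`, by antitonicity
of the gap clause in the rate). [folklore] -/
theorem isChiralAtZero_no_gap_above : ∀ (Nf : ℕ) (reg : QCDRegularisation Nf), reg.IsChiralAtZero → ∀ ε : ℝ, 0 < ε → ∃ m : Fin Nf → ℝ, (∀ f, 0 < m f) ∧ ∀ Δ : ℝ, ε ≤ Δ → ¬ (reg.scheme m 0 0).HasLatticeMassGap Δ := by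
  intro Nf reg hχ ε hε
  obtain ⟨m, hm, hng⟩ := hχ ε hε
  exact ⟨m, hm, fun Δ hle hgap => hng (hasLatticeMassGap_anti Nf (reg.scheme m 0 0) Δ ε hle hgap)⟩

end Summit.QuantumFields.QCD.Cruxes.StableActionBridge.Sketch
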